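import Literature.NumberTheory.CubicFields.ThreeTorsionParametrizationInjective
import Literature.NumberTheory.CubicFields.ThreeTorsionParametrizationModule
import Literature.NumberTheory.CubicFields.ThreeTorsionParametrizationSurjective
import HarnessLib

/-!
# Injectivity in Bhargava's parametrization, ideal form: `(x) I(C') = (y) I(C)`, `x³δ' = y³δ` force `C' ∼ C` (HCL I, Thm 13)

Topic `Literature/NumberTheory/CubicFields`, continuing `ThreeTorsionParametrizationInjective.lean`
(field level: a transition matrix `M ∈ GL₂(ℤ)` between the pairs forces `C' = C ∘ M`, `det M = 1`)
and `ThreeTorsionParametrizationModule.lean` (`I(C) = ℤθ₁ ⊕ ℤθ₂`). Tenth step of the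
class-field-theory-free road to the Davenport–Heilbronn theorem on `Cl(K)[3]`
(Bhargava–Varma 2016, §§2–3).

For the maximal order `𝓞 K = ℤ + ℤτ` of a quadratic field (`T : TauData K`) and two forms
`C, C'` of discriminant `d_K`: if the pairs `(I(C'), δ(C'))` and `(I(C), δ(C))` are equivalent —
`(x) · I(C') = (y) · I(C)` as ideals of `𝓞 K` and `x³ δ(C') = y³ δ(C)` for nonzero `x, y`
(i.e. `I' = κI`, `δ' = κ³δ`, `κ = y/x`; HCL I Thm 13: "equivalent triples") — then
**`C'` is `SL₂(ℤ)`-equivalent to `C`** (`sl2zEquiv_of_pair_equiv`). The equality of ideals gives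
integer transition matrices `M, M'` between the bases `(θ'₁, θ'₂)` and `(θ₁, θ₂)` with `M'M = 1`
(the `θᵢ` are `ℤ`-independent, `intCast_mul_theta_add_eq_zero`), and the field-level theorem
applies. Everything is proved.

## References

* M. Bhargava, *Higher composition laws I*, Ann. of Math. 159 (2004), §3.4, Thm 13
  [Bhargava2004HCL1].
* M. Bhargava, I. Varma, Proc. LMS 112 (2016) = arXiv:1401.5875, Thm 9 [BhargavaVarma2016].
-/

namespace Literature.NumberTheory.CubicFields

open NumberField Module
open scoped NumberField
open Literature.NumberTheory.QuadraticFields.Quadratic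

namespace SymCubic

variable {K : Type*} [Field K] [NumberField K] (h2 : finrank ℚ K = 2) (T : TauData K)

/-- `C ≠ 0` in the Hessian `(A, B, C)` when `disc` is not a square (else `disc = B²`). [folklore] -/
theorem hess_C_ne_zero_of_not_isSquare (a : SymCubic ℤ) (hD : ¬ IsSquare a.disc) : a.hess.2.2 ≠ 0 := by
  intro hC
  apply hD
  refine ⟨a.hess.2.1, ?_⟩
  have := discr_hess a
  rw [hC] at this
  linarith [this]

include h2 in
/-- **`θ₁(C), θ₂(C)` are `ℤ`-independent** (indeed `ℚ`-independent) for `disc C = d_K`: the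
oriented index `θ₁σθ₂ − σθ₁θ₂ = −AC·s ≠ 0`. Stated for integral representatives. [folklore] -/
theorem intCast_mul_theta_add_eq_zero (C : SymCubic ℤ) (hC : C.disc = NumberField.discr K)
    {t₁ t₂ : 𝓞 K} (ht₁ : (t₁ : K) = (C.thetaForm (T.s : K)).a₁) (ht₂ : (t₂ : K) = (C.thetaForm (T.s : K)).a₂)
    {m n : ℤ} (h : (m : 𝓞 K) * t₁ + (n : 𝓞 K) * t₂ = 0) : m = 0 ∧ n = 0 := by
  have hs : (T.s : K) ^ 2 = (C.disc : K) := by rw [hC]; exact T.sq_s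
  have hD : ¬ IsSquare C.disc := by rw [hC]; exact not_isSquare_discr h2
  have hσs := T.σ_s h2
  obtain ⟨-, c1, c2, -⟩ := conj_thetaForm C (T.σ h2) (s := (T.s : K)) hσs
  have hσ₁ : T.σ h2 (C.thetaForm (T.s : K)).a₁ = (C.thetaForm (T.s : K)).a₁ - (C.a₁ : K) * (T.s : K) := by
    rw [c1, thetaForm_a₁]; ring
  have hσ₂ : T.σ h2 (C.thetaForm (T.s : K)).a₂ = (C.thetaForm (T.s : K)).a₂ - (C.a₂ : K) * (T.s : K) := by
    rw [c2, thetaForm_a₂]; ring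
  have hidx := theta₁_mul_conj₂_sub C (s := (T.s : K))
  have hK : (m : K) * (C.thetaForm (T.s : K)).a₁ + (n : K) * (C.thetaForm (T.s : K)).a₂ = 0 := by
    have := congrArg (algebraMap (𝓞 K) K) h
    simp only [map_add, map_mul, map_intCast, map_zero] at this
    rw [← RingOfIntegers.coe_eq_algebraMap t₁, ← RingOfIntegers.coe_eq_algebraMap t₂, ht₁, ht₂] at this
    exact this
  have hKσ : (m : K) * ((C.thetaForm (T.s : K)).a₁ - (C.a₁ : K) * (T.s : K))
      + (n : K) * ((C.thetaForm (T.s : K)).a₂ - (C.a₂ : K) * (T.s : K)) = 0 := by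
    have := congrArg (T.σ h2) hK
    simp only [map_add, map_mul, map_intCast, map_zero, hσ₁, hσ₂] at this
    exact this
  have hAC : (C.hess.1 : K) * (C.hess.2.2 : K) * (T.s : K) ≠ 0 := by
    refine mul_ne_zero (mul_ne_zero ?_ ?_) ?_
    · exact_mod_cast hess_A_ne_zero_of_not_isSquare C hD
    · exact_mod_cast hess_C_ne_zero_of_not_isSquare C hD
    · exact s_ne_zero_of_not_isSquare C hs hD
  have hm : (m : K) * (-((C.hess.1 : K) * (C.hess.2.2 : K)) * (T.s : K)) = 0 := by
    rw [← hidx]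
    linear_combination ((C.thetaForm (T.s : K)).a₂ - (C.a₂ : K) * (T.s : K)) * hK
      - (C.thetaForm (T.s : K)).a₂ * hKσ
  have hm0 : m = 0 := by
    rcases mul_eq_zero.mp hm with h | h
    · exact_mod_cast h
    · exact absurd (by linear_combination -h) hAC
  have hn : (n : K) * (-((C.hess.1 : K) * (C.hess.2.2 : K)) * (T.s : K)) = 0 := by
    rw [← hidx]
    linear_combination -((C.thetaForm (T.s : K)).a₁ - (C.a₁ : K) * (T.s : K)) * hK
      + (C.thetaForm (T.s : K)).a₁ * hKσ
  have hn0 : n = 0 := by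
    rcases mul_eq_zero.mp hn with h | h
    · exact_mod_cast h
    · exact absurd (by linear_combination -h) hAC
  exact ⟨hm0, hn0⟩

include h2 in
/-- **Injectivity, ideal form** (HCL I Thm 13 / Bhargava–Varma Thm 9 for `𝓞 K`): if
`(x) · I(C') = (y) · I(C)` and `x³ δ(C') = y³ δ(C)` with `x, y ≠ 0`, then `C ∼ C'` under `SL₂(ℤ)`.
Here `δ(C) = t₁t₂`, `δ(C') = t₁'t₂'` through integral representatives of the `θ`'s.
[cite: Bhargava2004HCL1, §3.4 (Theorem 13: equivalent triples come from SL₂(ℤ)-equivalent forms)] -/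
theorem sl2zEquiv_of_pair_equiv (C C' : SymCubic ℤ) (hC : C.disc = NumberField.discr K)
    (hC' : C'.disc = NumberField.discr K)
    {t₁ t₂ t₁' t₂' : 𝓞 K} (ht₁ : (t₁ : K) = (C.thetaForm (T.s : K)).a₁)
    (ht₂ : (t₂ : K) = (C.thetaForm (T.s : K)).a₂) (ht₁' : (t₁' : K) = (C'.thetaForm (T.s : K)).a₁)
    (ht₂' : (t₂' : K) = (C'.thetaForm (T.s : K)).a₂)
    {x y : 𝓞 K} (hx : x ≠ 0) (hy : y ≠ 0)
    (hI : Ideal.span {x} * C'.cubicIdeal (T.s : K) = Ideal.span {y} * C.cubicIdeal (T.s : K))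
    (hδ : x ^ 3 * (t₁' * t₂') = y ^ 3 * (t₁ * t₂)) : SL2ZEquiv C C' := by
  have hs : (T.s : K) ^ 2 = (C.disc : K) := by rw [hC]; exact T.sq_s
  have hD : ¬ IsSquare C.disc := by rw [hC]; exact not_isSquare_discr h2
  have hdisc : C'.disc = C.disc := by rw [hC, hC']
  have hε := T.ε_eq
  have h4 : (4 : ℤ) ∣ C.disc - T.ε := by rw [hC]; exact T.four_dvd_discr_sub
  have h4' : (4 : ℤ) ∣ C'.disc - T.ε := by rw [hC']; exact T.four_dvd_discr_sub
  have hs' : (T.s : K) ^ 2 = (C'.disc : K) := by rw [hdisc]; exact hs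
  have hO : ∀ z : 𝓞 K, ∃ m n : ℤ, (z : K) = m + n * (((T.ε : K) + (T.s : K)) / 2) :=
    T.exists_int_coords_coe
  -- transition matrices
  have memI : ∀ {t : 𝓞 K}, t ∈ C'.cubicIdeal (T.s : K) →
      ∃ m n : ℤ, x * t = y * ((m : 𝓞 K) * t₁ + (n : 𝓞 K) * t₂) := by
    intro t ht
    have hmem : x * t ∈ Ideal.span {y} * C.cubicIdeal (T.s : K) := by
      rw [← hI]; exact Ideal.mul_mem_mul (Ideal.mem_span_singleton_self x) ht
    obtain ⟨z, hz, hzeq⟩ := Ideal.mem_span_singleton_mul.mp hmem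
    obtain ⟨m, n, rfl⟩ := (mem_cubicIdeal_iff C hs hε h4 hO ht₁ ht₂ z).mp hz
    exact ⟨m, n, hzeq.symm⟩
  have memI' : ∀ {t : 𝓞 K}, t ∈ C.cubicIdeal (T.s : K) →
      ∃ m n : ℤ, y * t = x * ((m : 𝓞 K) * t₁' + (n : 𝓞 K) * t₂') := by
    intro t ht
    have hmem : y * t ∈ Ideal.span {x} * C'.cubicIdeal (T.s : K) := by
      rw [hI]; exact Ideal.mul_mem_mul (Ideal.mem_span_singleton_self y) ht
    obtain ⟨z, hz, hzeq⟩ := Ideal.mem_span_singleton_mul.mp hmem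
    obtain ⟨m, n, rfl⟩ := (mem_cubicIdeal_iff C' hs' hε h4' hO ht₁' ht₂' z).mp hz
    exact ⟨m, n, hzeq.symm⟩
  have gen₁' : t₁' ∈ C'.cubicIdeal (T.s : K) := by
    rw [cubicIdeal_eq_span C' ht₁' ht₂']; exact Ideal.subset_span (by simp)
  have gen₂' : t₂' ∈ C'.cubicIdeal (T.s : K) := by
    rw [cubicIdeal_eq_span C' ht₁' ht₂']; exact Ideal.subset_span (by simp)
  have gen₁ : t₁ ∈ C.cubicIdeal (T.s : K) := by
    rw [cubicIdeal_eq_span C ht₁ ht₂]; exact Ideal.subset_span (by simp)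
  have gen₂ : t₂ ∈ C.cubicIdeal (T.s : K) := by
    rw [cubicIdeal_eq_span C ht₁ ht₂]; exact Ideal.subset_span (by simp)
  obtain ⟨m₁, n₁, h₁⟩ := memI gen₁'
  obtain ⟨m₂, n₂, h₂'⟩ := memI gen₂'
  obtain ⟨p₁, q₁, k₁⟩ := memI' gen₁
  obtain ⟨p₂, q₂, k₂⟩ := memI' gen₂
  -- `M'M = 1`
  have hxy : x * y ≠ 0 := mul_ne_zero hx hy
  have indep' := fun {m n : ℤ} (h : (m : 𝓞 K) * t₁' + (n : 𝓞 K) * t₂' = 0) =>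
    intCast_mul_theta_add_eq_zero h2 T C' hC' ht₁' ht₂' h
  have r1 : (x * y) * (((m₁ * p₁ + n₁ * p₂ - 1 : ℤ) : 𝓞 K) * t₁' + ((m₁ * q₁ + n₁ * q₂ : ℤ) : 𝓞 K) * t₂') = 0 := by
    push_cast
    linear_combination (-y) * h₁ - (y * (m₁ : 𝓞 K)) * k₁ - (y * (n₁ : 𝓞 K)) * k₂
  have r2 : (x * y) * (((m₂ * p₁ + n₂ * p₂ : ℤ) : 𝓞 K) * t₁' + ((m₂ * q₁ + n₂ * q₂ - 1 : ℤ) : 𝓞 K) * t₂') = 0 := by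
    push_cast
    linear_combination (-y) * h₂' - (y * (m₂ : 𝓞 K)) * k₁ - (y * (n₂ : 𝓞 K)) * k₂
  obtain ⟨e11, e12⟩ := indep' ((mul_eq_zero.mp r1).resolve_left hxy)
  obtain ⟨e21, e22⟩ := indep' ((mul_eq_zero.mp r2).resolve_left hxy)
  have hdet : (m₁ * n₂ - n₁ * m₂) * (p₁ * q₂ - q₁ * p₂) = 1 := by
    linear_combination (m₂ * q₁ + n₂ * q₂) * e11 + e22 - (m₂ * p₁ + n₂ * p₂) * e12
  have hunit : IsUnit (m₁ * n₂ - n₁ * m₂) := IsUnit.of_mul_eq_one _ hdet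
  -- to the field
  have hxK : (x : K) ≠ 0 := by exact_mod_cast hx
  have hyK : (y : K) ≠ 0 := by exact_mod_cast hy
  have castK : ∀ {u t a b : 𝓞 K} {m n : ℤ}, u * t = y * ((m : 𝓞 K) * a + (n : 𝓞 K) * b) →
      (u : K) * (t : K) = (y : K) * ((m : K) * (a : K) + (n : K) * (b : K)) := by
    intro u t a b m n h
    have := congrArg (algebraMap (𝓞 K) K) h
    simp only [map_add, map_mul, map_intCast] at this
    simp only [← RingOfIntegers.coe_eq_algebraMap] at this
    exact this
  have h₁K := castK h₁
  have h₂K := castK h₂'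
  rw [ht₁', ht₁, ht₂] at h₁K
  rw [ht₂', ht₁, ht₂] at h₂K
  have hδK : (x : K) ^ 3 * ((C'.thetaForm (T.s : K)).a₁ * (C'.thetaForm (T.s : K)).a₂)
      = (y : K) ^ 3 * ((C.thetaForm (T.s : K)).a₁ * (C.thetaForm (T.s : K)).a₂) := by
    have := congrArg (algebraMap (𝓞 K) K) hδ
    simp only [map_mul, map_pow] at this
    simp only [← RingOfIntegers.coe_eq_algebraMap] at this
    rw [ht₁, ht₂, ht₁', ht₂'] at this
    exact this
  exact sl2zEquiv_of_transition_of_isUnit C C' hs hdisc hD m₁ n₁ m₂ n₂ hxK hyK h₁K h₂K hδK hunit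

end SymCubic

end Literature.NumberTheory.CubicFields
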